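import Summits.ValiantsHypothesis.ValiantsHypothesis.Theses.DepthWindow
import Summits.ValiantsHypothesis.ValiantsHypothesis.Theorems.DepthWindowBinarisation
import Summits.ValiantsHypothesis.ValiantsHypothesis.Theorems.DepthWindowConstDepth
import Literature.Computability.AlgebraicComplexity.VSBRProductDepth
import Literature.Computability.AlgebraicComplexity.ValiantConjectureEquivProofs
import Literature.Computability.AlgebraicComplexity.StandardFamiliesProofs
import HarnessLib

/-!
# Route `DepthWindow` — the product-depth dial: necessity of both pieces (kernel) and the window brackets

Companion of the gate-written route file `Theses/DepthWindow.lean` (items `PerHardLog3` = A_{Δ₁}, `CollapseLog3`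
= B_{Δ₁} (declared RESIDUAL), `CollapseClog` = B_{⌈log₂ n⌉+1} (aside), deciding theorem `closes`;
Δ₁(n) = ⌊log₂⌊log₂⌊log₂ n⌋⌋⌋ + 1).  Decomp-valiant workshop, lens 4 «depth-reduction / chasm axis», generation 2;
authored by the lens seat; tagged node record `NODE-v2.md` in `run/shared/lean/pub/decomp-valiant/decomp-val-lens-4/`.
Unconditional, 0 sorry, no new definitions; it does NOT prove VP ≠ VNP and does NOT close either crux; it closes
the aside item `CollapseClog`.

THE DIAL (written out, no definitions): for a depth function `Δ : ℕ → ℕ`,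
`per ∈ D_Δ[poly]` := `∃ c, ∀ n, ∃ C : ArithCircuit ℂ (Fin n × Fin n), C.Computes per_n ∧ C.productDepth ≤ Δ n ∧
C.edgeSize ≤ n^c + c`; `A_Δ := ¬ (per ∈ D_Δ[poly])`; `B_Δ := VP ℂ = VNP ℂ → per ∈ D_Δ[poly]`.  The items are
`A_{Δ₁}`, `B_{Δ₁}`, `B_{⌈log₂ n⌉+1}` on the nose.

* §1 monotonicity in `Δ` and `B_Δ ↔ (A_Δ → VH)` (B is EXACTLY the declared residual of A).
* §2 NECESSITY OF A, KERNEL, EVERY DEPTH: `perHardAtDepth_of_vh : VH → A_Δ`, from the binarisation theorem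
  `complexity_eval_le_two_mul_edgeSize` (`DepthWindowBinarisation.lean`; generation 0 had this modulo the hypothesis
  `BinarisationBound`); hence `summit_iff_dial : VH ↔ A_Δ ∧ B_Δ` and the node iff
  `summit_iff_split : VH ↔ PerHardLog3 ∧ CollapseLog3` with no hypothesis.
* §3 TOP BRACKET: the VSBR rung `B_{⌈log₂ n⌉}` (`collapseToDepth_clog`, tree
  `DepthReduction.exists_computes_productDepth_le_clog`), the aside item (`collapseClog_holds : CollapseClog`) and
  `perHardAtDepth_clog_succ_iff_vh : A_{⌈log₂ n⌉+1} ↔ VH` — one bracket above the node the attackable piece IS the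
  summit.
* §4 BOTTOM BRACKET: the constant-depth rung `perHardConstDepth` (`DepthWindowConstDepth.lean`: LST transported to
  `per`) gives `collapseToDepth_const_iff_vh : B_{Δ₀} ↔ VH` for every constant `Δ₀` — one bracket below the node the
  residual IS the summit — and `perHardLog3_imp_perHardAtDepth_one : A_{Δ₁} → A_1`.

References: [ValiantSkyumBerkowitzRackoff1983]; [LimayeSrinivasanTavenas2025] Cor. 4; [Burgisser2000TCS] §2.
-/

-- layout Summits/ValiantsHypothesis/ValiantsHypothesis forces the duplicated namespace component
set_option linter.dupNamespace false

namespace Summit.ValiantsHypothesis.ValiantsHypothesis.Theorems.DepthWindow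

open MvPolynomial Literature.Computability.AlgebraicComplexity ArithCircuit
open Summit.ValiantsHypothesis.ValiantsHypothesis.Theses.DepthWindow

noncomputable section

/-! ## §1 The dial: monotonicity and the residual identity -/

/-- `D_Δ[poly]` grows with `Δ`. [folklore] -/
theorem perInDepthPoly_mono {Δ Δ' : ℕ → ℕ} (h : ∀ n, Δ n ≤ Δ' n) :
    (∃ c : ℕ, ∀ n : ℕ, ∃ C : ArithCircuit ℂ (Fin n × Fin n),
      C.Computes (perPoly (Fin n) ℂ) ∧ C.productDepth ≤ Δ n ∧ C.edgeSize ≤ n ^ c + c) →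
    (∃ c : ℕ, ∀ n : ℕ, ∃ C : ArithCircuit ℂ (Fin n × Fin n),
      C.Computes (perPoly (Fin n) ℂ) ∧ C.productDepth ≤ Δ' n ∧ C.edgeSize ≤ n ^ c + c) := by
  rintro ⟨c, hc⟩
  refine ⟨c, fun n => ?_⟩
  obtain ⟨C, h1, h2, h3⟩ := hc n
  exact ⟨C, h1, h2.trans (h n), h3⟩

/-- `A_Δ` is antitone in `Δ`. [folklore] -/
theorem perHardAtDepth_anti {Δ Δ' : ℕ → ℕ} (h : ∀ n, Δ n ≤ Δ' n) :
    (¬ ∃ c : ℕ, ∀ n : ℕ, ∃ C : ArithCircuit ℂ (Fin n × Fin n),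
      C.Computes (perPoly (Fin n) ℂ) ∧ C.productDepth ≤ Δ' n ∧ C.edgeSize ≤ n ^ c + c) →
    (¬ ∃ c : ℕ, ∀ n : ℕ, ∃ C : ArithCircuit ℂ (Fin n × Fin n),
      C.Computes (perPoly (Fin n) ℂ) ∧ C.productDepth ≤ Δ n ∧ C.edgeSize ≤ n ^ c + c) :=
  fun hA hP => hA (perInDepthPoly_mono h hP)

/-- `B_Δ` is monotone in `Δ`. [folklore] -/
theorem collapseToDepth_mono {Δ Δ' : ℕ → ℕ} (h : ∀ n, Δ n ≤ Δ' n) :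
    (VP ℂ = VNP ℂ → ∃ c : ℕ, ∀ n : ℕ, ∃ C : ArithCircuit ℂ (Fin n × Fin n),
      C.Computes (perPoly (Fin n) ℂ) ∧ C.productDepth ≤ Δ n ∧ C.edgeSize ≤ n ^ c + c) →
    (VP ℂ = VNP ℂ → ∃ c : ℕ, ∀ n : ℕ, ∃ C : ArithCircuit ℂ (Fin n × Fin n),
      C.Computes (perPoly (Fin n) ℂ) ∧ C.productDepth ≤ Δ' n ∧ C.edgeSize ≤ n ^ c + c) :=
  fun hB hEq => perInDepthPoly_mono h (hB hEq)

/-- Necessity of `B_Δ` (vacuous under VH). [folklore] -/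
theorem collapseToDepth_of_vh (Δ : ℕ → ℕ) (h : _root_.ValiantsHypothesis) :
    VP ℂ = VNP ℂ → ∃ c : ℕ, ∀ n : ℕ, ∃ C : ArithCircuit ℂ (Fin n × Fin n),
      C.Computes (perPoly (Fin n) ℂ) ∧ C.productDepth ≤ Δ n ∧ C.edgeSize ≤ n ^ c + c :=
  fun hEq => absurd hEq h

/-- **`B_Δ` is exactly the declared residual of `A_Δ`**: `B_Δ ↔ (A_Δ → VH)` (the `mp` direction is the route's
two-line assembly `A → B → VH`). [folklore] -/
theorem collapseToDepth_iff_residual (Δ : ℕ → ℕ) :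
    (VP ℂ = VNP ℂ → ∃ c : ℕ, ∀ n : ℕ, ∃ C : ArithCircuit ℂ (Fin n × Fin n),
      C.Computes (perPoly (Fin n) ℂ) ∧ C.productDepth ≤ Δ n ∧ C.edgeSize ≤ n ^ c + c) ↔
    ((¬ ∃ c : ℕ, ∀ n : ℕ, ∃ C : ArithCircuit ℂ (Fin n × Fin n),
      C.Computes (perPoly (Fin n) ℂ) ∧ C.productDepth ≤ Δ n ∧ C.edgeSize ≤ n ^ c + c) →
      _root_.ValiantsHypothesis) := by
  constructor
  · intro hB hA hEq
    exact hA (hB hEq)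
  · intro h hEq
    by_contra hno
    exact (h hno) hEq

/-! ## §2 Necessity of `A_Δ` — KERNEL at every depth (binarisation) -/

/-- **Necessity of `A_Δ` for EVERY depth function `Δ`, kernel**: `VH → A_Δ` (a polynomial-wire circuit family
for `per`, of any depth, binarises to a polynomial-size fan-in-two family by
`complexity_eval_le_two_mul_edgeSize`, so `per ∈ VP`, so `VP = VNP` by `isPComputable_perPoly_complex_iff`).
[cite: Burgisser2000TCS, §2] -/
theorem perHardAtDepth_of_vh (Δ : ℕ → ℕ) (h : _root_.ValiantsHypothesis) :
    ¬ ∃ c : ℕ, ∀ n : ℕ, ∃ C : ArithCircuit ℂ (Fin n × Fin n),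
      C.Computes (perPoly (Fin n) ℂ) ∧ C.productDepth ≤ Δ n ∧ C.edgeSize ≤ n ^ c + c := by
  rintro ⟨c, hc⟩
  refine h (isPComputable_perPoly_complex_iff.mp ?_)
  have hb : IsPBounded fun n : ℕ => 2 * (n ^ c + c) :=
    IsPBounded.mul_holds (IsPBounded.const 2) ⟨c, fun n => le_rfl⟩
  refine hb.mono fun n => ?_
  obtain ⟨C, hC, -, hCe⟩ := hc n
  rw [ArithCircuit.Computes] at hC
  show complexity (perPoly (Fin n) ℂ) ≤ 2 * (n ^ c + c)
  rw [← hC]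
  exact (complexity_eval_le_two_mul_edgeSize C).trans (Nat.mul_le_mul_left 2 hCe)

/-- The dial iff at every depth, kernel: `VH ↔ A_Δ ∧ B_Δ`. [folklore] -/
theorem summit_iff_dial (Δ : ℕ → ℕ) :
    _root_.ValiantsHypothesis ↔
      (¬ ∃ c : ℕ, ∀ n : ℕ, ∃ C : ArithCircuit ℂ (Fin n × Fin n),
        C.Computes (perPoly (Fin n) ℂ) ∧ C.productDepth ≤ Δ n ∧ C.edgeSize ≤ n ^ c + c) ∧
      (VP ℂ = VNP ℂ → ∃ c : ℕ, ∀ n : ℕ, ∃ C : ArithCircuit ℂ (Fin n × Fin n),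
        C.Computes (perPoly (Fin n) ℂ) ∧ C.productDepth ≤ Δ n ∧ C.edgeSize ≤ n ^ c + c) :=
  ⟨fun h => ⟨perHardAtDepth_of_vh Δ h, collapseToDepth_of_vh Δ h⟩,
    fun h => (collapseToDepth_iff_residual Δ).mp h.2 h.1⟩

/-- **The node iff, kernel, no hypothesis**: `VH ↔ PerHardLog3 ∧ CollapseLog3` (generation 0 had it modulo the
typed hypothesis `BinarisationBound`); the `mpr` direction is the route's deciding theorem `closes`. [folklore] -/
theorem summit_iff_split : _root_.ValiantsHypothesis ↔ PerHardLog3 ∧ CollapseLog3 :=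
  ⟨fun h => (summit_iff_dial fun n => Nat.log 2 (Nat.log 2 (Nat.log 2 n)) + 1).mp h, fun h => closes h.1 h.2⟩

/-! ## §3 Top bracket: the VSBR rung and `A_{⌈log₂ n⌉+1} ↔ VH` -/

/-- The VSBR wire bound is monotone in the size parameter. [cite: ValiantSkyumBerkowitzRackoff1983] -/
theorem vsbrEdgeBound_mono_s {N d s s' : ℕ} (h : s ≤ s') :
    DepthReduction.vsbrEdgeBound N d s ≤ DepthReduction.vsbrEdgeBound N d s' := by
  unfold DepthReduction.vsbrEdgeBound
  gcongr

/-- The VSBR wire bound at polynomial size is polynomially bounded. [cite: ValiantSkyumBerkowitzRackoff1983] -/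
theorem isPBounded_vsbrEdgeBound (c : ℕ) :
    IsPBounded fun n : ℕ => DepthReduction.vsbrEdgeBound (n * n) n (n ^ c + c) := by
  have hid : IsPBounded fun n : ℕ => n := IsPBounded.id
  have hs : IsPBounded fun n : ℕ => n ^ c + c := ⟨c, fun n => le_rfl⟩
  have h1 : IsPBounded fun n : ℕ => n + 1 := IsPBounded.add_holds hid (IsPBounded.const 1)
  have hN : IsPBounded fun n : ℕ => n * n + 1 :=
    IsPBounded.add_holds (IsPBounded.mul_holds hid hid) (IsPBounded.const 1)
  have hinner : IsPBounded fun n : ℕ => 4 * (n ^ c + c) * (n + 1) ^ 2 + 1 :=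
    IsPBounded.add_holds (IsPBounded.mul_holds (IsPBounded.mul_holds (IsPBounded.const 4) hs)
      (IsPBounded.pow_holds h1 2)) (IsPBounded.const 1)
  have h : IsPBounded fun n : ℕ =>
      9 * (4 * (n ^ c + c) * (n + 1) ^ 2 + 1) ^ 4 * (n * n + 1) * (n + 1) :=
    IsPBounded.mul_holds (IsPBounded.mul_holds (IsPBounded.mul_holds (IsPBounded.const 9)
      (IsPBounded.pow_holds hinner 4)) hN) h1
  exact h.mono fun n => le_of_eq rfl

/-- **VSBR rung** `B_{⌈log₂ n⌉}` (generation 0's proof, from the tree's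
`DepthReduction.exists_computes_productDepth_le_clog`). [cite: ValiantSkyumBerkowitzRackoff1983] -/
theorem collapseToDepth_clog :
    VP ℂ = VNP ℂ → ∃ c : ℕ, ∀ n : ℕ, ∃ C : ArithCircuit ℂ (Fin n × Fin n),
      C.Computes (perPoly (Fin n) ℂ) ∧ C.productDepth ≤ Nat.clog 2 n ∧ C.edgeSize ≤ n ^ c + c := by
  intro hEq
  have hP : IsPComputable (fun n => perPoly (Fin n) ℂ) := isPComputable_perPoly_complex_iff.mpr hEq
  obtain ⟨c, hc⟩ := hP
  obtain ⟨c', hc'⟩ := isPBounded_vsbrEdgeBound c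
  refine ⟨c', fun n => ?_⟩
  have hd : (perPoly (Fin n) ℂ).totalDegree ≤ n := by
    rw [totalDegree_perPoly_holds (n := Fin n) (k := ℂ), Fintype.card_fin]
  obtain ⟨C, hC, hCΔ, hCe⟩ :=
    DepthReduction.exists_computes_productDepth_le_clog (perPoly (Fin n) ℂ) hd
  refine ⟨C, hC, hCΔ, ?_⟩
  calc C.edgeSize ≤ DepthReduction.vsbrEdgeBound (Fintype.card (Fin n × Fin n)) n
            (complexity (perPoly (Fin n) ℂ)) := hCe
      _ ≤ DepthReduction.vsbrEdgeBound (n * n) n (n ^ c + c) := by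
          rw [Fintype.card_prod, Fintype.card_fin]; exact vsbrEdgeBound_mono_s (hc n)
      _ ≤ n ^ c' + c' := hc' n

/-- The ledger aside item `CollapseClog` (`B_{⌈log₂ n⌉+1}`) holds. [cite: ValiantSkyumBerkowitzRackoff1983] -/
theorem collapseClog_holds : CollapseClog :=
  collapseToDepth_mono (Δ := fun n => Nat.clog 2 n) (fun _ => Nat.le_succ _) collapseToDepth_clog

/-- **Top bracket (kernel iff)**: at depth `⌈log₂ n⌉ + 1` the attackable piece IS the summit,
`A_{⌈log₂ n⌉+1} ↔ VH`. [cite: ValiantSkyumBerkowitzRackoff1983] -/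
theorem perHardAtDepth_clog_succ_iff_vh :
    (¬ ∃ c : ℕ, ∀ n : ℕ, ∃ C : ArithCircuit ℂ (Fin n × Fin n),
      C.Computes (perPoly (Fin n) ℂ) ∧ C.productDepth ≤ Nat.clog 2 n + 1 ∧ C.edgeSize ≤ n ^ c + c) ↔
    _root_.ValiantsHypothesis :=
  ⟨fun hA => (collapseToDepth_iff_residual fun n => Nat.clog 2 n + 1).mp collapseClog_holds hA,
    fun h => perHardAtDepth_of_vh _ h⟩

/-- The node's depth lies below the VSBR depth: `Δ₁(n) ≤ ⌈log₂ n⌉ + 1`. [folklore] -/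
theorem log3Depth_le_clog_succ (n : ℕ) :
    Nat.log 2 (Nat.log 2 (Nat.log 2 n)) + 1 ≤ Nat.clog 2 n + 1 := by
  have h1 : Nat.log 2 (Nat.log 2 (Nat.log 2 n)) ≤ Nat.log 2 (Nat.log 2 n) := Nat.log_le_self _ _
  have h2 : Nat.log 2 (Nat.log 2 n) ≤ Nat.log 2 n := Nat.log_le_self _ _
  have h3 : Nat.log 2 n ≤ Nat.clog 2 n := Nat.log_le_clog _ _
  omega

/-! ## §4 Bottom bracket: the constant-depth rung read on the dial -/

/-- **Bottom bracket (kernel iff)**: at every constant depth the residual IS the summit, `B_{Δ₀} ↔ VH`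
(from `perHardConstDepth`). [cite: LimayeSrinivasanTavenas2025, Cor. 4] -/
theorem collapseToDepth_const_iff_vh (Δ₀ : ℕ) :
    (VP ℂ = VNP ℂ → ∃ c : ℕ, ∀ n : ℕ, ∃ C : ArithCircuit ℂ (Fin n × Fin n),
      C.Computes (perPoly (Fin n) ℂ) ∧ C.productDepth ≤ Δ₀ ∧ C.edgeSize ≤ n ^ c + c) ↔
    _root_.ValiantsHypothesis :=
  ⟨fun hB => (collapseToDepth_iff_residual fun _ => Δ₀).mp hB (perHardConstDepth Δ₀),
    fun h => collapseToDepth_of_vh (fun _ => Δ₀) h⟩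

/-- The crux sits above the proved rung: `A_{Δ₁} → A_1` (`1 ≤ Δ₁(n)` pointwise). [folklore] -/
theorem perHardLog3_imp_perHardAtDepth_one (hA : PerHardLog3) :
    ¬ ∃ c : ℕ, ∀ n : ℕ, ∃ C : ArithCircuit ℂ (Fin n × Fin n),
      C.Computes (perPoly (Fin n) ℂ) ∧ C.productDepth ≤ 1 ∧ C.edgeSize ≤ n ^ c + c :=
  perHardAtDepth_anti (Δ := fun _ => 1) (Δ' := fun n => Nat.log 2 (Nat.log 2 (Nat.log 2 n)) + 1)
    (fun n => by omega) hA

/-- **The window certificate**: the node's pieces sit strictly between two kernel identities with the summit —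
below, `B_{Δ₀} ↔ VH` for every constant `Δ₀`; above, `A_{⌈log₂ n⌉+1} ↔ VH` — with `1 ≤ Δ₁(n) ≤ ⌈log₂ n⌉ + 1`.
[folklore] -/
theorem window_certificate (Δ₀ : ℕ) :
    ((VP ℂ = VNP ℂ → ∃ c : ℕ, ∀ n : ℕ, ∃ C : ArithCircuit ℂ (Fin n × Fin n),
        C.Computes (perPoly (Fin n) ℂ) ∧ C.productDepth ≤ Δ₀ ∧ C.edgeSize ≤ n ^ c + c) ↔
      _root_.ValiantsHypothesis) ∧
    ((¬ ∃ c : ℕ, ∀ n : ℕ, ∃ C : ArithCircuit ℂ (Fin n × Fin n),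
        C.Computes (perPoly (Fin n) ℂ) ∧ C.productDepth ≤ Nat.clog 2 n + 1 ∧ C.edgeSize ≤ n ^ c + c) ↔
      _root_.ValiantsHypothesis) ∧
    (∀ n, 1 ≤ Nat.log 2 (Nat.log 2 (Nat.log 2 n)) + 1 ∧
      Nat.log 2 (Nat.log 2 (Nat.log 2 n)) + 1 ≤ Nat.clog 2 n + 1) :=
  ⟨collapseToDepth_const_iff_vh Δ₀, perHardAtDepth_clog_succ_iff_vh,
    fun n => ⟨by omega, log3Depth_le_clog_succ n⟩⟩

end

end Summit.ValiantsHypothesis.ValiantsHypothesis.Theorems.DepthWindow
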